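import Summits.BirchSwinnertonDyer.BirchSwinnertonDyer.Theorems.AdditiveKolyvaginRoadKolyvaginPrimitiveAdditiveParity
import Literature.NumberTheory.EllipticCurves.CasselsTateLevelInputs
import Literature.NumberTheory.EllipticCurves.WeilPairingProofs
import Literature.NumberTheory.EllipticCurves.HeegnerPointsKolyvaginSelmerProofs
import Literature.NumberTheory.EllipticCurves.ShaFiniteProofs
import Literature.GroupTheory.FiniteAbelian.SymplecticModulesLevel
import Literature.Algebra.Module.AlternatingPairingParity
import HarnessLib

/-!
# Route `AdditiveKolyvaginRoad`, crux `KolyvaginPrimitiveAdditive` (item stmt-BirchSwinnertonDyer-20132):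
# the p-PARITY stub P `stub_oddSelmerRankAdditive` FROM THE ROUTE'S OWN BINDERS — the LEVELWISE Cassels–Tate inputs
# `casselsTate_levelInputs` (conjunct 1 of item `PublishedDualityInputsAdditiveKoly`, stmt-21333) REPLACE the all-levels
# fact `exists_casselsTate_pairing` of `oddSelmerRankAdditive_of_published` (p507430)
# (p-generic port of koly g16's `…KolyvaginRoadThreeMethod2OddSelmerRankOfLevelInputs`, `3 ↦ p` odd)
# (cell `pub/bsd-wall`, lead prover `bsd-wall-akr-p1` g4; `--supports stmt-BirchSwinnertonDyer-20132`, helper)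

WHY. The composition item `KolyvaginPrimitiveOfLevelSystemsAdditive` (stmt-21266: PUB → DUAL → KS → BOT → KPA) grants
`DUAL.1 = ∀ K, casselsTate_levelInputs K` (tenure g7, rev 18), not `exists_casselsTate_pairing`; the parity step P of the
skeleton must therefore be re-derived from the levelwise inputs, exactly as at `p = 3`: on a ♯ frame `Ш(E/K)` is FINITE
(Kolyvagin), so ONE level `q = p^k` killing `Ш[p^∞]` suffices — there Milne's level pairing is non-degenerate on
`Ш[p^k] ⊇ Ш[p]` (`nondegenerate_of_isLevelPairing`) and a finite abelian `p`-group with a non-degenerate alternating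
pairing has even `p`-rank (`exists_natCard_torsionBy_eq_pow_two_mul`); with `rank E(K) = 1` and `E(K)[p] = 0`,
`#Sel_p(E/K) = p · 1 · #Ш[p] = p^{1+2m}` (AEC X.4.2, `natCard_selmerGroup_eq`).

THEOREMS (0 defs, 0 named facts, 0 `sorry`): `odd_selmerRank_of_rankOne_of_finiteSha_of_levelPairings_prime` (any
number field, any prime), `exists_isLevelPairing_sha_baseChange_of_casselsTateLevelInputs_prime` (the binder instantiated
at an odd `p` with the tree's Weil pairing and the complex conjugation of `K`), and
`oddSelmerRankAdditive_of_levelInputs` — THE REGISTERED STUB P SIGNATURE as conclusion, CONDITIONAL on Gross–Zagier,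
Kolyvagin, modularity (PUB) and the levelwise Cassels–Tate inputs (DUAL.1), all published. Closes nothing by itself.

References: [cite: MilneADT2006, Ch. I §6, Prop. 6.9, Thm. 6.13(a)] [cite: Cassels1962ArithmeticIV]
[cite: SilvermanAEC2009, Thm. X.4.2, Prop. III.8.1] [cite: GrossZagier1986Heegner, Thm. I.6.3]
[cite: KolyvaginEulerSystems1990, Thm. A] [cite: WZhang2014, Thm. 9.2] [cite: GrossLMS1991, Prop. 2.3].
-/

-- single-conjunct summit: `Summit.BirchSwinnertonDyer.BirchSwinnertonDyer.…` repeats the name by design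
set_option linter.dupNamespace false

noncomputable section

open scoped Classical AddSubgroup

namespace Summit.BirchSwinnertonDyer.BirchSwinnertonDyer.Theorems.AdditiveKoly

open WeierstrassCurve NumberField IsDedekindDomain Literature.NumberTheory.EllipticCurves
  Literature.NumberTheory.EllipticCurves.ModularForms
  Literature.NumberTheory.EllipticCurves.Rank1Residual
  Literature.NumberTheory.GaloisRepresentations Literature.NumberTheory.GaloisCohomology
  Literature.GroupTheory.FiniteAbelian
  Summit.BirchSwinnertonDyer.Rank1Residual Summit.BirchSwinnertonDyer.Rank1Residual.X11b Module

/-! ## Rank one + `Ш` finite + no `p`-torsion + level pairings on `Ш[p^k]` ⇒ odd `p`-Selmer rank -/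

/-- **Odd `p`-Selmer rank from rank one, with the Cassels–Tate input in LEVELWISE form** (any number field, any prime
`p`). For `rank E(K) = 1`, `Ш(E/K)` finite, `E(K)[p] = 0`, and at every level `p^k` (`k ≥ 1`) an alternating pairing
on `Ш[p^k]` with kernel `Ш[p^k] ∩ p^k Ш` (`IsLevelPairing`): `#Sel_p(E/K) = p^s` with `s` ODD (`#Sel_p = p^{rank} ·
#E(K)[p] · #Ш[p]`, AEC X.4.2; at a level killing `Ш[p^∞]` the pairing is non-degenerate, so `#Ш[p] = p^{2m}`).
[cite: MilneADT2006, Ch. I §6, Thm. 6.13(a)] [cite: SilvermanAEC2009, Thm. X.4.2] -/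
theorem odd_selmerRank_of_rankOne_of_finiteSha_of_levelPairings_prime {F : Type} [Field F] [NumberField F]
    (E : WeierstrassCurve F) [E.IsElliptic] (p : ℕ) [hp : Fact p.Prime] (hrank : E.mordellWeilRank = 1)
    (hSha : Finite E.sha) (htors : AddSubgroup.torsionBy E.toAffine.Point ((p : ℕ) : ℤ) = ⊥)
    (hlev : ∀ k : ℕ, 0 < k →
      ∃ B : (E.sha)[((p ^ k : ℕ) : ℤ)] →+ (E.sha)[((p ^ k : ℕ) : ℤ)] →+ AddCircle (1 : ℚ),
        IsLevelPairing (p ^ k) B) :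
    ∃ s : ℕ, Odd s ∧ Nat.card (E.selmerGroup ((p : ℕ) : ℤ)) = p ^ s := by
  have hpp : p.Prime := hp.out
  haveI := hSha
  -- a level `p^k`, `k ≥ 1`, killing the `p`-primary part of the finite group `Ш`
  set k : ℕ := padicValNat p (Nat.card E.sha) + 1 with hkdef
  have hkpos : 0 < k := Nat.succ_pos _
  have hcard0 : Nat.card E.sha ≠ 0 := Nat.card_pos.ne'
  have hkill : ∀ z : E.sha, (∃ j : ℕ, p ^ j • z = 0) → p ^ k • z = 0 := by
    rintro z ⟨j, hj⟩
    have hdvd : addOrderOf z ∣ p ^ j := addOrderOf_dvd_iff_nsmul_eq_zero.mpr hj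
    obtain ⟨a, -, ha⟩ := (Nat.dvd_prime_pow hpp).mp hdvd
    have han : p ^ a ∣ Nat.card E.sha := ha ▸ addOrderOf_dvd_natCard z
    have hale : a ≤ padicValNat p (Nat.card E.sha) := (padicValNat_dvd_iff_le hcard0).mp han
    have hak : addOrderOf z ∣ p ^ k := by
      rw [ha]
      exact pow_dvd_pow p (by omega)
    exact addOrderOf_dvd_iff_nsmul_eq_zero.mp hak
  have hq : ∀ z : E.sha, (p ^ k * p ^ k) • z = 0 → p ^ k • z = 0 := fun z hz ↦
    hkill z ⟨k + k, by rwa [pow_add]⟩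
  obtain ⟨B, hB⟩ := hlev k hkpos
  have hnd : ∀ x : (E.sha)[((p ^ k : ℕ) : ℤ)], (∀ y, B x y = 0) → x = 0 :=
    nondegenerate_of_isLevelPairing hB hq
  have hQ : ∀ q : (E.sha)[((p ^ k : ℕ) : ℤ)], ∃ n : ℕ, p ^ n • q = 0 := fun q ↦
    ⟨k, Subtype.ext (by
      rw [AddSubgroupClass.coe_nsmul, ZeroMemClass.coe_zero]
      have h := (Submodule.mem_torsionBy_iff _ _).mp q.2
      rwa [natCast_zsmul] at h)⟩
  obtain ⟨m, hm⟩ :=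
    Literature.Algebra.Module.exists_natCard_torsionBy_eq_pow_two_mul (p := p) hQ B hB.1 hnd
  have hle : (E.sha)[((p : ℕ) : ℤ)] ≤ (E.sha)[((p ^ k : ℕ) : ℤ)] := by
    intro x hx
    refine (Submodule.mem_torsionBy_iff _ _).mpr ?_
    have h3 : ((p : ℕ) : ℤ) • x = 0 := (Submodule.mem_torsionBy_iff _ _).mp hx
    obtain ⟨c, hc⟩ : ((p : ℕ) : ℤ) ∣ ((p ^ k : ℕ) : ℤ) := by
      exact_mod_cast dvd_pow_self p hkpos.ne'
    change ((p ^ k : ℕ) : ℤ) • x = 0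
    rw [hc, mul_comm, mul_zsmul, h3, zsmul_zero]
  have hShap : Nat.card ((E.sha)[((p : ℕ) : ℤ)]) = p ^ (2 * m) := by
    rw [← hm, Literature.Algebra.Module.natCard_torsionBy_addSubgroup ((E.sha)[((p ^ k : ℕ) : ℤ)])
      ((p : ℕ) : ℤ), inf_eq_right.mpr hle]
  have hSel := E.natCard_selmerGroup_eq (n := p) (by exact_mod_cast hpp.ne_zero)
  have ht : Nat.card (E.toAffine.Point[((p : ℕ) : ℤ)]) = 1 := by
    rw [htors, AddSubgroup.card_bot]
  have hinf : Nat.card (E.sha ⊓ AddSubgroup.torsionBy E.galH1 ((p : ℕ) : ℤ) : AddSubgroup E.galH1) =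
      Nat.card ((E.sha)[((p : ℕ) : ℤ)]) :=
    (Literature.Algebra.Module.natCard_torsionBy_addSubgroup E.sha ((p : ℕ) : ℤ)).symm
  refine ⟨2 * m + 1, odd_two_mul_add_one m, ?_⟩
  rw [hSel, hrank, ht, hinf, hShap]
  ring

/-! ## The binder `casselsTate_levelInputs` instantiated at an odd prime -/

/-- **Level pairings on `Ш(E/K)[p^k]` from `casselsTate_levelInputs K`** (conjunct 1 of item 21333), for `E = W/ℚ`
base-changed to an imaginary quadratic `K` and `p` odd: fed the complex conjugation of `K` and the Weil pairing on
`E[p^{2k}]` (tree THEOREM `exists_weilPairing_holds`); the fourth output is Milne's level pairing at `q = p^k`.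
[cite: MilneADT2006, Ch. I §6, Prop. 6.9, Thm. 6.13(a)] [cite: SilvermanAEC2009, Prop. III.8.1] -/
theorem exists_isLevelPairing_sha_baseChange_of_casselsTateLevelInputs_prime {K : Type} [Field K] [NumberField K]
    (hCT : casselsTate_levelInputs K) (hK : IsImaginaryQuadratic K) (W : WeierstrassCurve ℚ) [W.IsElliptic]
    (p : ℕ) [hp : Fact p.Prime] (hp2 : p ≠ 2) (k : ℕ) (hk : 0 < k) :
    ∃ B : ((W.baseChange K).sha)[((p ^ k : ℕ) : ℤ)] →+ ((W.baseChange K).sha)[((p ^ k : ℕ) : ℤ)] →+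
        AddCircle (1 : ℚ), IsLevelPairing (p ^ k) B := by
  have hpp : p.Prime := hp.out
  haveI : NeZero (p ^ k) := ⟨pow_ne_zero _ hpp.ne_zero⟩
  obtain ⟨c, hc, hcc⟩ := Literature.NumberTheory.EllipticCurves.exists_conj_of_isImaginaryQuadratic (K := K) hK
  have h2 : 2 ≤ p ^ k * p ^ k :=
    le_trans (le_trans hpp.two_le (Nat.le_self_pow hk.ne' p)) (Nat.le_mul_of_pos_right _ (NeZero.pos (p ^ k)))
  have hq : ((p ^ k * p ^ k : ℕ) : K) ≠ 0 := Nat.cast_ne_zero.mpr (NeZero.ne (p ^ k * p ^ k))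
  obtain ⟨e, hμ, hadd₁, hadd₂, halt, hnd, hgal⟩ := exists_weilPairing_holds (W.baseChange K) (p ^ k * p ^ k) h2 hq
  obtain ⟨inv, hPT', hH3, -, hB, -⟩ := hCT W p k hpp hp2 hk c hc hcc e hμ hadd₁ hadd₂ hgal halt hnd
  exact ⟨_, hB⟩

/-! ## The stub from the route's binders -/

/-- **`stub_oddSelmerRankAdditive` (registered text of skeleton v8 of crux 20132, VERBATIM) FROM THE ROUTE'S OWN
BINDERS.** At every ♯ additive frame `#Sel_p(E/K) = p^s` with `s` odd, from: Gross–Zagier `hGZ` + modularity `hmod`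
(the Heegner point `y_K` is non-torsion on the HL frame), Kolyvagin `hKo` (`rank E(K) = 1`, `Ш(E/K)` finite) —
conjuncts of `PublishedInputsAdditiveKoly` — and the LEVELWISE Cassels–Tate inputs `hCT` (conjunct 1 of
`PublishedDualityInputsAdditiveKoly`), in place of the all-levels fact of `oddSelmerRankAdditive_of_published`.
`E(K)[p] = 0` from `ρ̄` onto over the quadratic `K`. CONDITIONAL on the four named inputs (all published).
[cite: GrossZagier1986Heegner, Thm. I.6.3] [cite: KolyvaginEulerSystems1990, Thm. A] [cite: MilneADT2006, Ch. I §6,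
Thm. 6.13(a)] [cite: WZhang2014, Thm. 9.2] -/
theorem oddSelmerRankAdditive_of_levelInputs
    (hGZ : ∀ (N : ℕ) [NeZero N] (W : WeierstrassCurve ℚ) (K : Type) [Field K] [NumberField K], gross_zagier N W K)
    (hKo : ∀ (N : ℕ) [NeZero N] (W : WeierstrassCurve ℚ) (K : Type) [Field K] [NumberField K], kolyvagin N W K)
    (hmod : hasEntireLFunction_rat)
    (hCT : ∀ (K : Type) [Field K] [NumberField K], casselsTate_levelInputs K) :
    ∀ (W : WeierstrassCurve ℚ) [W.IsElliptic] [W.IsGloballyMinimal] [NeZero (W.conductorNorm ℤ)]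
      (p : ℕ) [Fact p.Prime] (K : Type) [Field K] [NumberField K]
      (Dt : ModularParametrizationData W (W.conductorNorm ℤ)) (β : ℤ) (ι : K →+* ℂ),
      5 ≤ p → Addv W p → W.HasSurjectiveModNGaloisRep p →
      (∀ (ℓ : ℕ) [Fact ℓ.Prime], W.HasMultiplicativeReductionAtPrime ℓ →
        ¬ p ∣ padicValInt ℓ W.minimalDiscriminantInt) →
      (∃ (ℓ₁ ℓ₂ : ℕ) (_ : Fact ℓ₁.Prime) (_ : Fact ℓ₂.Prime), ℓ₁ ≠ ℓ₂ ∧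
        W.HasMultiplicativeReductionAtPrime ℓ₁ ∧ W.HasMultiplicativeReductionAtPrime ℓ₂) →
      ¬ p ∣ W.tamagawaProduct → W.analyticRank = 1 →
      IsImaginaryQuadratic K → Odd (NumberField.discr K) →
      SatisfiesHeegnerHypothesis (W.conductorNorm ℤ) K →
      (W.quadraticTwist (NumberField.discr K : ℚ)).entireLFunction 1 ≠ 0 →
      (4 * (W.conductorNorm ℤ : ℤ)) ∣ β ^ 2 - NumberField.discr K → ¬ (p : ℤ) ∣ Dt.c →
      ∃ s : ℕ, Odd s ∧ Nat.card (WeierstrassCurve.selmerGroup (W.baseChange K) (p : ℤ)) = p ^ s := by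
  intro W _ _ _ p _ K _ _ Dt β ι h5 _hadd hsurj _hsp1 _hsp2 _htam hr1 hK _hodd hH hLt hβ _hc
  have hp : p.Prime := Fact.out
  have hp2 : p ≠ 2 := by omega
  -- `E[p]` irreducible (ρ̄ onto), hence `E(K)[p] = 0` over the quadratic field `K`
  have hirr : W.HasIrreducibleModPGaloisRep p := hasIrreducibleModPGaloisRep_of_hasSurjectiveModNGaloisRep W p hsurj
  have hbot := torsionBy_eq_bot_of_isImaginaryQuadratic_of_hasIrreducibleModPGaloisRep W K hK hp hirr
  -- THE Heegner point `P = y_K ∈ E(K)` of the frame, non-torsion by Gross–Zagier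
  have hDneg : NumberField.discr K < 0 := hK.discr_neg
  obtain ⟨H, -⟩ := exists_heegnerDatum (W.conductorNorm ℤ) hDneg hβ
  obtain ⟨P, hP⟩ := heegnerPointComplex_mem_range_map_holds (W.conductorNorm ℤ) W K hK hH Dt H ι
  have hPinf : ¬ IsOfFinAddOrder P :=
    not_isOfFinAddOrder_of_heegner_of_analyticRank_eq_one W (W.conductorNorm ℤ) K Dt H ι P (hGZ _ W K) hmod hr1 hK
      hH hLt hP
  -- Kolyvagin: rank one and `Ш(E/K)` finite
  obtain ⟨hrank, hSha⟩ := hKo _ W K hK hH ⟨Dt, H, ι, hP⟩ hPinf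
  have hlev := fun k hk ↦
    exists_isLevelPairing_sha_baseChange_of_casselsTateLevelInputs_prime (hCT K) hK W p hp2 k hk
  exact odd_selmerRank_of_rankOne_of_finiteSha_of_levelPairings_prime (W.baseChange K) p hrank hSha hbot hlev

end Summit.BirchSwinnertonDyer.BirchSwinnertonDyer.Theorems.AdditiveKoly

end
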